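import Literature.Computability.Cryptography.WordRAMSubrun
import HarnessLib

/-!
# The word RAM — structured programs around a loop of emulated sub-runs

Companion to `Literature.Computability.Cryptography.WordRAMSubrun` (one emulated sub-run between
two pieces of structured code). The algorithms of fine-grained complexity that call a hypothetical
algorithm *once per sub-instance* — the driver of a SERF reduction (Impagliazzo–Paturi–Zane,
JCSS 63 (2001), Cor. 1–2: run the sparse `k`-SAT algorithm on each of the `≤ 2^{εn}` sparsified
formulas and accept iff one accepts), or any disjunctive/Turing self-reduction (VVW, ICM 2018, §2,
the remark after Def. 2.1) — need the emulator of `…WordRAMEmulator` *inside a loop*. The structured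
layer `SProg` of `…WordRAMStructured` has no primitive for the emulator's raw code, so the loop is
assembled here once and for all at the level of program counters:

* `SProg.withSubrunLoop pre flag body L M post fin`: the program
  `pre; TEST: jz flag EXIT; body; ⟦emulator of M⟧; post; jmp TEST; EXIT: fin; halt`
  (`withSubrunLoop_isDeterministic`, `withSubrunLoop_isOracleFree`, `codeAt_withSubrunLoop`);
* **`SProg.outputsWithin_withSubrunLoop`**: the loop rule. Given an invariant `Inv i st` on stores
  (`i` iterations done), if `pre` reaches `Inv 0` from the initial store; if from `Inv i` (`i < N`)
  the flag register is nonzero, `body` reaches within `Tb` steps a store presenting to the emulator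
  (some admissible environment `E`, `EnvOK`/`TInv`/`Agree`) the initial memory of `M` on some input
  `y` on which `M` halts within `nmax` steps, and `post`, from every memory agreeing with `M`'s
  halting memory, reaches `Inv (i + 1)` within `Tp` steps; and if `Inv N` forces the flag to `0`
  and lets `fin` produce the read-out `out` within `Tf` steps — then the program outputs `out`
  within `t₀ + N · (Tb + cstep · nmax + Tp + 2) + Tf + 2` steps (`cstep = 38`).

## References

* R. Impagliazzo, R. Paturi, F. Zane, *Which problems have strongly exponential complexity?*,
  J. Comput. Syst. Sci. 63 (2001) 512–530, Cor. 1 and Cor. 2 (the SERF driver).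
* V. Vassilevska Williams, *On some fine-grained questions in algorithms and complexity*,
  Proc. ICM 2018, §2 (word RAM; algorithms calling an algorithm for another problem).
* T. Nipkow, G. Klein, *Concrete Semantics with Isabelle/HOL*, Springer 2014, §8.4, §12.2
  (compiler correctness; the `while` rule with a variant).
-/

namespace Literature.Computability.Cryptography.WordRAM

open StateTransition

namespace SProg

/-! ## The program -/

/-- Position of the loop test (right after `pre`). [folklore] -/
def loopTest (pre : SProg) : ℕ := pre.len

/-- Position of the loop body. [folklore] -/
def loopBodyPos (pre : SProg) : ℕ := pre.len + 1

/-- Position (base) of the emulator's code. [folklore] -/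
def loopEmuPos (pre body : SProg) : ℕ := pre.len + 1 + body.len

/-- Position of `post`: the emulator's exit. [folklore] -/
def loopPostPos (pre body : SProg) (L : Layout) (M : Program) : ℕ :=
  exitPos L 0 M (loopEmuPos pre body)

/-- Position of the back jump. [folklore] -/
def loopJmpPos (pre body : SProg) (L : Layout) (M : Program) (post : SProg) : ℕ :=
  loopPostPos pre body L M + post.len

/-- Position of `fin`: the loop exit. [folklore] -/
def loopExit (pre body : SProg) (L : Layout) (M : Program) (post : SProg) : ℕ :=
  loopJmpPos pre body L M post + 1

/-- **Structured code around a loop of emulated sub-runs**: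
`pre; TEST: jz flag EXIT; body; ⟦emulator of M⟧; post; jmp TEST; EXIT: fin; halt`. [folklore] -/
def withSubrunLoop (pre : SProg) (flag : ℕ) (body : SProg) (L : Layout) (M : Program)
    (post fin : SProg) : Program :=
  pre.compile 0 ++ [.jz (.dir flag) (loopExit pre body L M post)] ++
    body.compile (loopBodyPos pre) ++ emuCode L M (loopEmuPos pre body) ++
    post.compile (loopPostPos pre body L M) ++ [.jmp (loopTest pre)] ++
    fin.compile (loopExit pre body L M post) ++ [.halt]

/-- `withSubrunLoop` programs are deterministic. [folklore] -/
theorem withSubrunLoop_isDeterministic (pre : SProg) (flag : ℕ) (body : SProg) (L : Layout)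
    (M : Program) (post fin : SProg) : (withSubrunLoop pre flag body L M post fin).IsDeterministic := by
  intro I hI
  simp only [withSubrunLoop, List.mem_append, List.mem_singleton] at hI
  rcases hI with ((((((h | rfl) | h) | h) | h) | rfl) | h) | rfl
  · exact isRand_of_mem_compile pre 0 I h
  · rfl
  · exact isRand_of_mem_compile body _ I h
  · exact isRand_of_mem_emuCompile L M _ I h
  · exact isRand_of_mem_compile post _ I h
  · rfl
  · exact isRand_of_mem_compile fin _ I h
  · rfl

/-- `withSubrunLoop` programs with query-free structured parts are oracle-free. [folklore] -/
theorem withSubrunLoop_isOracleFree {pre body post fin : SProg} (hpre : pre.QueryFree)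
    (hbody : body.QueryFree) (hpost : post.QueryFree) (hfin : fin.QueryFree) (flag : ℕ)
    (L : Layout) (M : Program) : (withSubrunLoop pre flag body L M post fin).IsOracleFree := by
  intro I hI
  simp only [withSubrunLoop, List.mem_append, List.mem_singleton] at hI
  rcases hI with ((((((h | rfl) | h) | h) | h) | rfl) | h) | rfl
  · exact isQuery_of_mem_compile pre hpre 0 I h
  · rfl
  · exact isQuery_of_mem_compile body hbody _ I h
  · exact isQuery_of_mem_emuCompile L M _ I h
  · exact isQuery_of_mem_compile post hpost _ I h
  · rfl
  · exact isQuery_of_mem_compile fin hfin _ I h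
  · rfl

/-- Placement of the parts of `withSubrunLoop`. [folklore] -/
theorem codeAt_withSubrunLoop (pre : SProg) (flag : ℕ) (body : SProg) (L : Layout) (M : Program)
    (post fin : SProg) :
    CodeAt (withSubrunLoop pre flag body L M post fin) 0 (pre.compile 0) ∧
    (withSubrunLoop pre flag body L M post fin)[loopTest pre]? =
      some (.jz (.dir flag) (loopExit pre body L M post)) ∧
    CodeAt (withSubrunLoop pre flag body L M post fin) (loopBodyPos pre)
      (body.compile (loopBodyPos pre)) ∧
    CodeAt (withSubrunLoop pre flag body L M post fin) (loopEmuPos pre body)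
      (emuCode L M (loopEmuPos pre body)) ∧
    CodeAt (withSubrunLoop pre flag body L M post fin) (loopPostPos pre body L M)
      (post.compile (loopPostPos pre body L M)) ∧
    (withSubrunLoop pre flag body L M post fin)[loopJmpPos pre body L M post]? =
      some (.jmp (loopTest pre)) ∧
    CodeAt (withSubrunLoop pre flag body L M post fin) (loopExit pre body L M post)
      (fin.compile (loopExit pre body L M post)) ∧
    (withSubrunLoop pre flag body L M post fin)[loopExit pre body L M post + fin.len]? =
      some .halt := by
  set P := withSubrunLoop pre flag body L M post fin with hP
  have hex : loopEmuPos pre body + (emuCode L M (loopEmuPos pre body)).length =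
      loopPostPos pre body L M := length_emuCode L M _
  -- the eight cut points, as `P = A ++ B ++ C`
  have e1 : P = [] ++ pre.compile 0 ++ ([.jz (.dir flag) (loopExit pre body L M post)] ++
      body.compile (loopBodyPos pre) ++ emuCode L M (loopEmuPos pre body) ++
      post.compile (loopPostPos pre body L M) ++ [.jmp (loopTest pre)] ++
      fin.compile (loopExit pre body L M post) ++ [.halt]) := by
    simp [hP, withSubrunLoop]
  have e2 : P = pre.compile 0 ++ [.jz (.dir flag) (loopExit pre body L M post)] ++
      (body.compile (loopBodyPos pre) ++ emuCode L M (loopEmuPos pre body) ++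
      post.compile (loopPostPos pre body L M) ++ [.jmp (loopTest pre)] ++
      fin.compile (loopExit pre body L M post) ++ [.halt]) := by
    simp [hP, withSubrunLoop]
  have e3 : P = (pre.compile 0 ++ [.jz (.dir flag) (loopExit pre body L M post)]) ++
      body.compile (loopBodyPos pre) ++ (emuCode L M (loopEmuPos pre body) ++
      post.compile (loopPostPos pre body L M) ++ [.jmp (loopTest pre)] ++
      fin.compile (loopExit pre body L M post) ++ [.halt]) := by
    simp [hP, withSubrunLoop]
  have e4 : P = (pre.compile 0 ++ [.jz (.dir flag) (loopExit pre body L M post)] ++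
      body.compile (loopBodyPos pre)) ++ emuCode L M (loopEmuPos pre body) ++
      (post.compile (loopPostPos pre body L M) ++ [.jmp (loopTest pre)] ++
      fin.compile (loopExit pre body L M post) ++ [.halt]) := by
    simp [hP, withSubrunLoop]
  have e5 : P = (pre.compile 0 ++ [.jz (.dir flag) (loopExit pre body L M post)] ++
      body.compile (loopBodyPos pre) ++ emuCode L M (loopEmuPos pre body)) ++
      post.compile (loopPostPos pre body L M) ++ ([.jmp (loopTest pre)] ++
      fin.compile (loopExit pre body L M post) ++ [.halt]) := by
    simp [hP, withSubrunLoop]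
  have e6 : P = (pre.compile 0 ++ [.jz (.dir flag) (loopExit pre body L M post)] ++
      body.compile (loopBodyPos pre) ++ emuCode L M (loopEmuPos pre body) ++
      post.compile (loopPostPos pre body L M)) ++ [.jmp (loopTest pre)] ++
      (fin.compile (loopExit pre body L M post) ++ [.halt]) := by
    simp [hP, withSubrunLoop]
  have e7 : P = (pre.compile 0 ++ [.jz (.dir flag) (loopExit pre body L M post)] ++
      body.compile (loopBodyPos pre) ++ emuCode L M (loopEmuPos pre body) ++
      post.compile (loopPostPos pre body L M) ++ [.jmp (loopTest pre)]) ++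
      fin.compile (loopExit pre body L M post) ++ [.halt] := by
    simp [hP, withSubrunLoop]
  have e8 : P = (pre.compile 0 ++ [.jz (.dir flag) (loopExit pre body L M post)] ++
      body.compile (loopBodyPos pre) ++ emuCode L M (loopEmuPos pre body) ++
      post.compile (loopPostPos pre body L M) ++ [.jmp (loopTest pre)] ++
      fin.compile (loopExit pre body L M post)) ++ [.halt] ++ [] := by
    simp [hP, withSubrunLoop]
  have h1 := codeAt_of_eq_append e1
  have h2 := codeAt_of_eq_append e2
  have h3 := codeAt_of_eq_append e3
  have h4 := codeAt_of_eq_append e4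
  have h5 := codeAt_of_eq_append e5
  have h6 := codeAt_of_eq_append e6
  have h7 := codeAt_of_eq_append e7
  have h8 := codeAt_of_eq_append e8
  simp only [List.length_append, List.length_cons, List.length_nil, length_compile] at h1 h2 h3 h4
  simp only [List.length_append, List.length_cons, List.length_nil, length_compile] at h5 h6 h7 h8
  have hpos3 : pre.len + (0 + 1) = loopBodyPos pre := rfl
  have hpos4 : pre.len + (0 + 1) + body.len = loopEmuPos pre body := rfl
  have hpos5 : pre.len + (0 + 1) + body.len + (emuCode L M (loopEmuPos pre body)).length =
      loopPostPos pre body L M := by rw [hpos4]; exact hex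
  have hpos6 : pre.len + (0 + 1) + body.len + (emuCode L M (loopEmuPos pre body)).length +
      post.len = loopJmpPos pre body L M post := by rw [hpos5]; rfl
  have hpos7 : pre.len + (0 + 1) + body.len + (emuCode L M (loopEmuPos pre body)).length +
      post.len + (0 + 1) = loopExit pre body L M post := by rw [hpos6]; rfl
  have hpos8 : pre.len + (0 + 1) + body.len + (emuCode L M (loopEmuPos pre body)).length +
      post.len + (0 + 1) + fin.len = loopExit pre body L M post + fin.len := by rw [hpos7]
  refine ⟨h1, ?_, ?_, ?_, ?_, ?_, ?_, ?_⟩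
  · exact h2.getElem?_zero
  · rw [hpos3] at h3; exact h3
  · rw [hpos4] at h4; exact h4
  · rw [hpos5] at h5; exact h5
  · rw [hpos6] at h6; exact h6.getElem?_zero
  · rw [hpos7] at h7; exact h7
  · rw [hpos8] at h8; exact h8.getElem?_zero

/-! ## The loop rule -/

/-- **Output certificate of a program with a loop of emulated sub-runs.** See the module
docstring. The invariant `Inv i st` speaks about stores (memory and query log); the environment
`E`, the value bound `V`, the emulated input `y`, the halting configuration `dh` and the halting
time `n ≤ nmax` of the `i`-th sub-run are produced by the `i`-th body execution. [folklore] -/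
theorem outputsWithin_withSubrunLoop {W : ℕ} {O : List ℕ → List ℕ} (ρ : ℕ → ℕ)
    {pre body post fin : SProg} {flag : ℕ} {L : Layout} {VT : ℕ} {M : Program} {x out : List ℕ}
    {st₀ : Store} {t₀ N Tb Tp Tf nmax : ℕ} (Inv : ℕ → Store → Prop)
    (hx : inputWidth x ≤ W) (hpre : Exec W O pre ⟨initFun x, []⟩ st₀ t₀) (h0 : Inv 0 st₀)
    (hVT : VT + 1 = 2 ^ W) (h1 : 1 ≤ VT) (hregV : ∀ r ∈ L.regs, r ≤ VT)
    (hdet : M.IsDeterministic) (hof : M.IsOracleFree)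
    (hbody : ∀ i, i < N → ∀ st, Inv i st → st.mem flag ≠ 0 ∧
      ∃ (st₁ : Store) (t₁ : ℕ), t₁ ≤ Tb ∧ Exec W O body st st₁ t₁ ∧
      ∃ (E : Env) (V : ℕ) (y : List ℕ) (n : ℕ) (dh : Cfg),
        EnvOK L E W ∧ Program.maxConst M ≤ V ∧ V < E.Q ∧ V ≤ VT ∧ 2 ^ E.ws - 1 ≤ V ∧ 1 ≤ V ∧
        TInv L E VT st₁.mem ∧ Agree E st₁.mem (init E.ws y).mem ∧
        HaltsWithin M E.ws noOracle zeroCoins y n dh ∧ n ≤ nmax ∧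
        ∀ m₂ : ℕ → ℕ, Agree E m₂ dh.mem → TInv L E VT m₂ →
          (∀ c, ¬ Foot L E c → m₂ c = st₁.mem c) →
          ∃ (st₃ : Store) (t₃ : ℕ), t₃ ≤ Tp ∧ Exec W O post ⟨m₂, st₁.queries⟩ st₃ t₃ ∧
            Inv (i + 1) st₃)
    (hexit : ∀ st, Inv N st → st.mem flag = 0 ∧
      ∃ (st' : Store) (t' : ℕ), t' ≤ Tf ∧ Exec W O fin st st' t' ∧ readOut st'.mem = out) :
    OutputsWithin (withSubrunLoop pre flag body L M post fin) W O ρ x out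
      (t₀ + N * (Tb + cstep * nmax + Tp + 2) + Tf + 2) := by
  obtain ⟨hc₁, hjz, hc₃, hc₄, hc₅, hjmp, hc₇, hhalt⟩ :=
    codeAt_withSubrunLoop pre flag body L M post fin
  set P := withSubrunLoop pre flag body L M post fin
  -- the build
  have hrun₀ : run P W O ρ t₀ (init W x) = some (st₀.cfg (some (loopTest pre)) 0) := by
    have h := hpre.run_eq hc₁ 0 ρ
    have hinit : (⟨initFun x, []⟩ : Store).cfg (some 0) 0 = init W x := by
      rw [← init_mem_eq_initFun hx]; rfl
    rwa [hinit, Nat.zero_add] at h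
  -- the iterations: from `Inv i` at the test (coin position `cp`) to `Inv N` at the test
  have hiter : ∀ j, ∀ i, i + j = N → ∀ (st : Store) (cp : ℕ), Inv i st →
      ∃ (m : ℕ) (st' : Store) (cp' : ℕ), m ≤ j * (Tb + cstep * nmax + Tp + 2) ∧
        run P W O ρ m (st.cfg (some (loopTest pre)) cp) = some (st'.cfg (some (loopTest pre)) cp') ∧
        Inv N st' := by
    intro j
    induction j with
    | zero =>
      intro i hi st cp hst
      rw [Nat.add_zero] at hi
      subst hi
      exact ⟨0, st, cp, Nat.zero_le _, rfl, hst⟩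
    | succ j ih =>
      intro i hi st cp hst
      have hiN : i < N := by omega
      obtain ⟨hflag, st₁, t₁, ht₁, hexb, E, V, y, n, dh, hOK, hMV, hVQ, hVVT, hwsV, h1V, hinv, hag,
        hM, hn, hpost⟩ := hbody i hiN st hst
      -- the test falls through
      have hs1 : step P W O ρ (st.cfg (some (loopTest pre)) cp) =
          some (st.cfg (some (loopBodyPos pre)) cp) := by
        rw [step_jz_ne (i := loopTest pre) rfl hjz (by simpa using hflag)]
        rfl
      -- the body
      have hrunb : run P W O ρ t₁ (st.cfg (some (loopBodyPos pre)) cp) =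
          some (st₁.cfg (some (loopEmuPos pre body)) cp) := hexb.run_eq hc₃ cp ρ
      -- the emulated sub-run
      obtain ⟨n', hn', hrunM, hstepM⟩ := hM.exists_run
      have hpcM : dh.pc = none := (step_eq_none_iff _ _ _ _ _).1 hstepM
      have hrel : ERel L E VT M (loopEmuPos pre body) 0 (init E.ws y)
          (st₁.cfg (some (loopEmuPos pre body)) cp) :=
        ⟨by simp [bstart_zero], hag, hinv⟩
      have hdm : MemLE V (init E.ws y).mem := init_memLE _ _ hwsV
      obtain ⟨m, hm, eh, hrune, hpce, hage, hinve, hcoe, hque, hfre⟩ :=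
        emu_halt hOK hVT h1 hregV length_noQB hc₄ hdet hof hMV hVQ hVVT hwsV h1V O ρ hrel hdm
          hrunM hpcM
      -- the read-out
      obtain ⟨st₃, t₃, ht₃, hexp, hst₃⟩ := hpost eh.mem hage hinve (fun c hc => by
        simpa using hfre c hc)
      have heh : eh = (⟨eh.mem, st₁.queries⟩ : Store).cfg (some (loopPostPos pre body L M)) cp := by
        cases eh
        simp only [Store.cfg_queries, Store.cfg_coinPos] at hpce hque hcoe
        simp only [Store.cfg, hpce, hque, hcoe, loopPostPos]
      have hrunp : run P W O ρ t₃ eh =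
          some (st₃.cfg (some (loopJmpPos pre body L M post)) cp) := by
        have h := hexp.run_eq hc₅ cp ρ
        rwa [← heh] at h
      -- the back jump
      have hs2 : step P W O ρ (st₃.cfg (some (loopJmpPos pre body L M post)) cp) =
          some (st₃.cfg (some (loopTest pre)) cp) := by
        rw [step_jmp (i := loopJmpPos pre body L M post) rfl hjmp]
        rfl
      -- the remaining iterations
      obtain ⟨m', st', cp', hm', hrun', hst'⟩ := ih (i + 1) (by omega) st₃ cp hst₃
      refine ⟨1 + t₁ + m + t₃ + 1 + m', st', cp', ?_, ?_, hst'⟩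
      · have : m ≤ cstep * nmax := hm.trans (Nat.mul_le_mul_left _ (hn'.trans hn))
        rw [Nat.succ_mul]; omega
      · have hA : run P W O ρ (1 + t₁) (st.cfg (some (loopTest pre)) cp) =
            some (st₁.cfg (some (loopEmuPos pre body)) cp) := by
          rw [Nat.add_comm, run_succ_of_step _ _ _ _ hs1, hrunb]
        have hB := run_add_of_run _ _ _ _ (run_add_of_run _ _ _ _ hA hrune) hrunp
        have hC : run P W O ρ (1 + t₁ + m + t₃ + 1) (st.cfg (some (loopTest pre)) cp) =
            some (st₃.cfg (some (loopTest pre)) cp) := by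
          rw [run_add_of_run _ _ _ _ hB]
          rw [run_one, hs2]
        exact run_add_of_run _ _ _ _ hC hrun'
  obtain ⟨m, stN, cpN, hm, hrunN, hstN⟩ := hiter N 0 (Nat.zero_add N) st₀ 0 h0
  -- the exit
  obtain ⟨hflag0, st', t', ht', hexf, hout⟩ := hexit stN hstN
  have hs3 : step P W O ρ (stN.cfg (some (loopTest pre)) cpN) =
      some (stN.cfg (some (loopExit pre body L M post)) cpN) := by
    rw [step_jz_zero (i := loopTest pre) rfl hjz (by simpa using hflag0)]
    rfl
  have hrunf : run P W O ρ t' (stN.cfg (some (loopExit pre body L M post)) cpN) =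
      some (st'.cfg (some (loopExit pre body L M post + fin.len)) cpN) := hexf.run_eq hc₇ cpN ρ
  have hs4 : run P W O ρ 1 (st'.cfg (some (loopExit pre body L M post + fin.len)) cpN) =
      some (st'.cfg none cpN) := by
    rw [run_one, step_halt (i := loopExit pre body L M post + fin.len) rfl hhalt]
    rfl
  have hD : run P W O ρ (m + 1) (st₀.cfg (some (loopTest pre)) 0) =
      some (stN.cfg (some (loopExit pre body L M post)) cpN) := by
    rw [run_add_of_run _ _ _ _ hrunN]
    rw [run_one, hs3]
  have hall := run_add_of_run _ _ _ _ (run_add_of_run _ _ _ _ (run_add_of_run _ _ _ _ hrun₀ hD)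
    hrunf) hs4
  have hT : t₀ + (m + 1) + t' + 1 ≤ t₀ + N * (Tb + cstep * nmax + Tp + 2) + Tf + 2 := by omega
  have := outputsWithin_of_run hall (step_of_pc_eq_none rfl) hT
  rwa [Store.cfg_mem, hout] at this

/-- **The loop rule with a summed body budget.** As `outputsWithin_withSubrunLoop`, but the `i`-th
body execution is bounded by its own `Tb i` and the conclusion charges `∑ i < N, Tb i` (for loops
whose iterations have very different costs, e.g. one iteration per item of a list of varying item
sizes). [folklore] -/
theorem outputsWithin_withSubrunLoop_sum {W : ℕ} {O : List ℕ → List ℕ} (ρ : ℕ → ℕ)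
    {pre body post fin : SProg} {flag : ℕ} {L : Layout} {VT : ℕ} {M : Program} {x out : List ℕ}
    {st₀ : Store} {t₀ N Tp Tf nmax : ℕ} (Tb : ℕ → ℕ) (Inv : ℕ → Store → Prop)
    (hx : inputWidth x ≤ W) (hpre : Exec W O pre ⟨initFun x, []⟩ st₀ t₀) (h0 : Inv 0 st₀)
    (hVT : VT + 1 = 2 ^ W) (h1 : 1 ≤ VT) (hregV : ∀ r ∈ L.regs, r ≤ VT)
    (hdet : M.IsDeterministic) (hof : M.IsOracleFree)
    (hbody : ∀ i, i < N → ∀ st, Inv i st → st.mem flag ≠ 0 ∧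
      ∃ (st₁ : Store) (t₁ : ℕ), t₁ ≤ Tb i ∧ Exec W O body st st₁ t₁ ∧
      ∃ (E : Env) (V : ℕ) (y : List ℕ) (n : ℕ) (dh : Cfg),
        EnvOK L E W ∧ Program.maxConst M ≤ V ∧ V < E.Q ∧ V ≤ VT ∧ 2 ^ E.ws - 1 ≤ V ∧ 1 ≤ V ∧
        TInv L E VT st₁.mem ∧ Agree E st₁.mem (init E.ws y).mem ∧
        HaltsWithin M E.ws noOracle zeroCoins y n dh ∧ n ≤ nmax ∧
        ∀ m₂ : ℕ → ℕ, Agree E m₂ dh.mem → TInv L E VT m₂ →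
          (∀ c, ¬ Foot L E c → m₂ c = st₁.mem c) →
          ∃ (st₃ : Store) (t₃ : ℕ), t₃ ≤ Tp ∧ Exec W O post ⟨m₂, st₁.queries⟩ st₃ t₃ ∧
            Inv (i + 1) st₃)
    (hexit : ∀ st, Inv N st → st.mem flag = 0 ∧
      ∃ (st' : Store) (t' : ℕ), t' ≤ Tf ∧ Exec W O fin st st' t' ∧ readOut st'.mem = out) :
    OutputsWithin (withSubrunLoop pre flag body L M post fin) W O ρ x out
      (t₀ + (Finset.range N).sum Tb + N * (cstep * nmax + Tp + 2) + Tf + 2) := by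
  obtain ⟨hc₁, hjz, hc₃, hc₄, hc₅, hjmp, hc₇, hhalt⟩ :=
    codeAt_withSubrunLoop pre flag body L M post fin
  set P := withSubrunLoop pre flag body L M post fin
  -- the build
  have hrun₀ : run P W O ρ t₀ (init W x) = some (st₀.cfg (some (loopTest pre)) 0) := by
    have h := hpre.run_eq hc₁ 0 ρ
    have hinit : (⟨initFun x, []⟩ : Store).cfg (some 0) 0 = init W x := by
      rw [← init_mem_eq_initFun hx]; rfl
    rwa [hinit, Nat.zero_add] at h
  -- the iterations: from `Inv i` at the test to `Inv N` at the test
  have hiter : ∀ j, ∀ i, i + j = N → ∀ (st : Store) (cp : ℕ), Inv i st →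
      ∃ (m : ℕ) (st' : Store) (cp' : ℕ),
        m ≤ (Finset.range j).sum (fun t => Tb (i + t)) + j * (cstep * nmax + Tp + 2) ∧
        run P W O ρ m (st.cfg (some (loopTest pre)) cp) = some (st'.cfg (some (loopTest pre)) cp') ∧
        Inv N st' := by
    intro j
    induction j with
    | zero =>
      intro i hi st cp hst
      rw [Nat.add_zero] at hi
      subst hi
      exact ⟨0, st, cp, Nat.zero_le _, rfl, hst⟩
    | succ j ih =>
      intro i hi st cp hst
      have hiN : i < N := by omega
      obtain ⟨hflag, st₁, t₁, ht₁, hexb, E, V, y, n, dh, hOK, hMV, hVQ, hVVT, hwsV, h1V, hinv, hag,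
        hM, hn, hpost⟩ := hbody i hiN st hst
      -- the test falls through
      have hs1 : step P W O ρ (st.cfg (some (loopTest pre)) cp) =
          some (st.cfg (some (loopBodyPos pre)) cp) := by
        rw [step_jz_ne (i := loopTest pre) rfl hjz (by simpa using hflag)]
        rfl
      -- the body
      have hrunb : run P W O ρ t₁ (st.cfg (some (loopBodyPos pre)) cp) =
          some (st₁.cfg (some (loopEmuPos pre body)) cp) := hexb.run_eq hc₃ cp ρ
      -- the emulated sub-run
      obtain ⟨n', hn', hrunM, hstepM⟩ := hM.exists_run
      have hpcM : dh.pc = none := (step_eq_none_iff _ _ _ _ _).1 hstepM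
      have hrel : ERel L E VT M (loopEmuPos pre body) 0 (init E.ws y)
          (st₁.cfg (some (loopEmuPos pre body)) cp) :=
        ⟨by simp [bstart_zero], hag, hinv⟩
      have hdm : MemLE V (init E.ws y).mem := init_memLE _ _ hwsV
      obtain ⟨m, hm, eh, hrune, hpce, hage, hinve, hcoe, hque, hfre⟩ :=
        emu_halt hOK hVT h1 hregV length_noQB hc₄ hdet hof hMV hVQ hVVT hwsV h1V O ρ hrel hdm
          hrunM hpcM
      -- the read-out
      obtain ⟨st₃, t₃, ht₃, hexp, hst₃⟩ := hpost eh.mem hage hinve (fun c hc => by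
        simpa using hfre c hc)
      have heh : eh = (⟨eh.mem, st₁.queries⟩ : Store).cfg (some (loopPostPos pre body L M)) cp := by
        cases eh
        simp only [Store.cfg_queries, Store.cfg_coinPos] at hpce hque hcoe
        simp only [Store.cfg, hpce, hque, hcoe, loopPostPos]
      have hrunp : run P W O ρ t₃ eh =
          some (st₃.cfg (some (loopJmpPos pre body L M post)) cp) := by
        have h := hexp.run_eq hc₅ cp ρ
        rwa [← heh] at h
      -- the back jump
      have hs2 : step P W O ρ (st₃.cfg (some (loopJmpPos pre body L M post)) cp) =
          some (st₃.cfg (some (loopTest pre)) cp) := by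
        rw [step_jmp (i := loopJmpPos pre body L M post) rfl hjmp]
        rfl
      -- the remaining iterations
      obtain ⟨m', st', cp', hm', hrun', hst'⟩ := ih (i + 1) (by omega) st₃ cp hst₃
      refine ⟨1 + t₁ + m + t₃ + 1 + m', st', cp', ?_, ?_, hst'⟩
      · have : m ≤ cstep * nmax := hm.trans (Nat.mul_le_mul_left _ (hn'.trans hn))
        have hfun : (fun t => Tb (i + (t + 1))) = (fun t => Tb (i + 1 + t)) := by
          funext t; rw [Nat.add_assoc, Nat.add_comm 1 t]
        have hsplit : (Finset.range (j + 1)).sum (fun t => Tb (i + t)) =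
            (Finset.range j).sum (fun t => Tb (i + 1 + t)) + Tb i := by
          rw [Finset.sum_range_succ', hfun]; simp only [Nat.add_zero]
        rw [hsplit, Nat.succ_mul]; omega
      · have hA : run P W O ρ (1 + t₁) (st.cfg (some (loopTest pre)) cp) =
            some (st₁.cfg (some (loopEmuPos pre body)) cp) := by
          rw [Nat.add_comm, run_succ_of_step _ _ _ _ hs1, hrunb]
        have hB := run_add_of_run _ _ _ _ (run_add_of_run _ _ _ _ hA hrune) hrunp
        have hC : run P W O ρ (1 + t₁ + m + t₃ + 1) (st.cfg (some (loopTest pre)) cp) =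
            some (st₃.cfg (some (loopTest pre)) cp) := by
          rw [run_add_of_run _ _ _ _ hB]
          rw [run_one, hs2]
        exact run_add_of_run _ _ _ _ hC hrun'
  obtain ⟨m, stN, cpN, hm, hrunN, hstN⟩ := hiter N 0 (Nat.zero_add N) st₀ 0 h0
  simp only [Nat.zero_add] at hm
  -- the exit
  obtain ⟨hflag0, st', t', ht', hexf, hout⟩ := hexit stN hstN
  have hs3 : step P W O ρ (stN.cfg (some (loopTest pre)) cpN) =
      some (stN.cfg (some (loopExit pre body L M post)) cpN) := by
    rw [step_jz_zero (i := loopTest pre) rfl hjz (by simpa using hflag0)]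
    rfl
  have hrunf : run P W O ρ t' (stN.cfg (some (loopExit pre body L M post)) cpN) =
      some (st'.cfg (some (loopExit pre body L M post + fin.len)) cpN) := hexf.run_eq hc₇ cpN ρ
  have hs4 : run P W O ρ 1 (st'.cfg (some (loopExit pre body L M post + fin.len)) cpN) =
      some (st'.cfg none cpN) := by
    rw [run_one, step_halt (i := loopExit pre body L M post + fin.len) rfl hhalt]
    rfl
  have hD : run P W O ρ (m + 1) (st₀.cfg (some (loopTest pre)) 0) =
      some (stN.cfg (some (loopExit pre body L M post)) cpN) := by
    rw [run_add_of_run _ _ _ _ hrunN]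
    rw [run_one, hs3]
  have hall := run_add_of_run _ _ _ _ (run_add_of_run _ _ _ _ (run_add_of_run _ _ _ _ hrun₀ hD)
    hrunf) hs4
  have hT : t₀ + (m + 1) + t' + 1 ≤ t₀ + (Finset.range N).sum Tb + N * (cstep * nmax + Tp + 2) + Tf + 2 := by
    have : (Finset.range N).sum (fun t => Tb t) = (Finset.range N).sum Tb := rfl
    omega
  have := outputsWithin_of_run hall (step_of_pc_eq_none rfl) hT
  rwa [Store.cfg_mem, hout] at this

end SProg

end Literature.Computability.Cryptography.WordRAM
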